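import Literature.Computability.Complexity.LadnerPresentationCook
import Literature.Computability.Complexity.OrbitDecidersExists
import Literature.Computability.Complexity.ListFoldBricks
import HarnessLib

/-!
# Ladner's theorem: bricks of the looking-back diagonalizer (enumeration, search, clocks)

Fourth layer of the discharge of `Literature.Computability.Complexity.ladner` (`StructuralPH.lean`).
The diagonalizer of `LadnerArgument.lean` (`Ladner.IsDiagonalizer`) is a polynomial-time machine
which, at stage `n`, spends a budget `n` "looking back" (Ladner 1975, §3; Chew–Machtey 1981, §2):
it decides short strings of the `NP` language `A` by exhaustive search, runs presented clocked
machines and oracle procedures through the universal machine, and compares. This file supplies,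
in the tree's `FP` string algebra (`BrickAlgebra.lean`, `FoldBricks.lean`), the bricks it is
assembled from, each with its value on honest records and its membership in `FP`:

* `Ladner.nextFn` — the successor of the enumeration of all strings by (length, value)
  (`PolyExistsEnum.next`, Homer–Selman 2011, Thm. 5.10, proof: "the lexicographically next string";
  its length facts from `OrbitDecidersExists.lean`);
* `Ladner.searchFn χ p` — **exhaustive search for a certificate**: on `⟨r, w⟩` (ruler `r`), the bit
  `[∃ y, |y| ≤ p |w| ∧ χ ⟨w, y⟩ = 1]`, by a counted loop over the `2^{p|w|+1} - 1` candidates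
  (correct as soon as the ruler affords that many rounds, `searchFn_apply`); with `χ` the
  indicator of a verifier language this decides an `NP` language on short inputs;
* `Ladner.powFn` — binary powers `⟦base⟧ᵐ` by a counted fold of products (`Brick.foldAcc_prodFn`),
  `Ladner.leF` — the comparison `[⟦a⟧ ≤ ⟦b⟧]`, and the binary numerals of the two clocks
  `clock₁`, `clock₂` of the presented oracle procedures (`Ladner.clockBinFn`, for a code
  `c = ⟨e, u⟩` and an input `z`: `(|z|+2)^{|u|}` and `(2|z| + 6(|z|+2)^{|u|} + 6)^{|u|}`).

## References

* R. E. Ladner, *On the structure of polynomial time reducibility*, J. ACM 22 (1975) 155–171, §3.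
* P. Chew, M. Machtey, *A note on structure and looking back …*, J. Comput. System Sci. 22 (1981)
  53–59, §2. doi:10.1016/0022-0000(81)90021-0
* S. Homer, A. L. Selman, *Computability and Complexity Theory*, 2nd ed., Springer 2011, Thm. 5.10
  (proof), Thm. 7.6 (proof). doi:10.1007/978-1-4614-0682-2
* S. Arora, B. Barak, *Computational Complexity: A Modern Approach*, CUP 2009, §1.3 (bounded
  loops), Def. 2.1 (certificates), Claim 2.4 (exhaustive search).
-/

noncomputable section

namespace Literature.Computability.Complexity

open _root_.Computability Polynomial Brick
open PolyExistsEnum (next cand)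

namespace Ladner

/-! ### The successor of the enumeration of all strings -/

/-- **The successor of the (length, value) enumeration of strings** as a brick: at an all-ones
string (carry out, `CoinEnum.carryFn`) the zero string of the next length, otherwise the
little-endian increment (`CoinEnum.incFn`). [cite: HomerSelman2011, Thm. 5.10 (proof, step 4)] -/
def nextFn : List Bool → List Bool :=
  iteFn CoinEnum.carryFn (List.cons false ∘ Kannan.zerosFn) CoinEnum.incFn

/-- `nextFn` is `PolyExistsEnum.next`. [folklore] -/
@[simp] theorem nextFn_apply (y : List Bool) : nextFn y = next y := by
  unfold nextFn PolyExistsEnum.next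
  cases h : TokConv.co true y
  · rw [iteFn_apply_false (by simp [h]), if_neg (by simp)]
    simp
  · rw [iteFn_apply_true (by simp [h]), if_pos rfl]
    simp [List.replicate_succ]

/-- `nextFn ∈ FP`. [folklore] -/
theorem nextFn_mem_FP : nextFn ∈ FP :=
  iteFn_mem_FP CoinEnum.carryFn_mem_FP
    (comp_mem_FP (cons_mem_FP false) Kannan.zerosFn_mem_FP) CoinEnum.incFn_mem_FP

/-- Iterated successors lengthen a string by at most the number of iterations. [folklore] -/
theorem length_next_iterate_le (k : ℕ) (y : List Bool) : (next^[k] y).length ≤ y.length + k := by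
  induction k with
  | zero => simp
  | succ k ih =>
    rw [Function.iterate_succ_apply']
    exact (OrbitDecider.Exists.length_next_le _).trans (by omega)

/-- The `k`-th candidate has length at most `k`. [folklore] -/
theorem length_cand_le (k : ℕ) : (cand k).length ≤ k := by
  have h := length_next_iterate_le k []
  rw [List.length_nil, Nat.zero_add] at h
  exact h

/-! ### Exhaustive search for a certificate -/

section Search

variable (χ : List Bool → List Bool) (p : Polynomial ℕ)

/-- The test of one candidate: `[χ ⟨w, y⟩ = 1 ∧ |y| ≤ p |w|]` on the loop record
`⟨⟨r, w⟩, ⟨cnt, ⟨y, found⟩⟩⟩`. [cite: AroraBarakCC2009, Def. 2.1 (certificates)] -/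
def testC : List Bool → List Bool :=
  andFn (HashBricks.headBitFn ∘ χ ∘ fanoutFn (sndF ∘ nthF 0) (nthF 2))
    (lenLeFn p ∘ fanoutFn (sndF ∘ nthF 0) (nthF 2))

/-- **Body of the search loop**: `⟨y, found⟩ ↦ ⟨next y, found ∨ test y⟩`. [cite: AroraBarakCC2009, Claim 2.4 (exhaustive search)] -/
def searchBody : List Bool → List Bool :=
  fanoutFn (nextFn ∘ nthF 2) (orFn (HashBricks.headBitFn ∘ sndPow 2) (testC χ p))

/-- `testC` is one-bit. [folklore] -/
theorem oneBit_testC : OneBit (testC χ p) :=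
  oneBit_andFn (HashBricks.oneBit_headBitFn.comp _) fun z => by
    unfold Function.comp; rw [fanoutFn_apply, lenLeFn_boolPair]; exact ⟨_, rfl⟩

/-- Value of the test on a record. [folklore] -/
theorem testC_apply (r w cnt y fd : List Bool) :
    testC χ p (boolPair (boolPair r w) (boolPair cnt (boolPair y fd))) =
      [(χ (boolPair w y)).headD false && decide (y.length ≤ p.eval w.length)] := by
  unfold testC
  rw [andFn_apply (b := (χ (boolPair w y)).headD false) (b' := decide (y.length ≤ p.eval w.length))]
  · simp [nthF, Function.comp_apply]
  · simp [nthF, Function.comp_apply, lenLeFn_boolPair]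

/-- Value of the body on a record. [folklore] -/
theorem searchBody_apply (r w cnt y fd : List Bool) :
    searchBody χ p (boolPair (boolPair r w) (boolPair cnt (boolPair y fd))) =
      boolPair (next y) [fd.headD false ||
        ((χ (boolPair w y)).headD false && decide (y.length ≤ p.eval w.length))] := by
  unfold searchBody
  rw [fanoutFn_apply, orFn_apply (b := fd.headD false)
    (b' := (χ (boolPair w y)).headD false && decide (y.length ≤ p.eval w.length))]
  · simp [nthF]
  · simp [sndPow]
  · exact testC_apply χ p r w cnt y fd

/-- `searchBody ∈ FP` for `χ ∈ FP`. [folklore] -/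
theorem searchBody_mem_FP (hχ : χ ∈ FP) : searchBody χ p ∈ FP := by
  have hpair : fanoutFn (sndF ∘ nthF 0) (nthF 2) ∈ FP :=
    fanoutFn_mem_FP (comp_mem_FP sndF_mem_FP (nthF_mem_FP 0)) (nthF_mem_FP 2)
  exact fanoutFn_mem_FP (comp_mem_FP nextFn_mem_FP (nthF_mem_FP 2))
    (orFn_mem_FP (comp_mem_FP HashBricks.headBitFn_mem_FP (sndPow_mem_FP 2))
      (andFn_mem_FP (comp_mem_FP HashBricks.headBitFn_mem_FP (comp_mem_FP hχ hpair))
        (comp_mem_FP (lenLeFn_mem_FP p) hpair)))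

/-- Growth of the body: `|searchBody z| ≤ |sndPow 1 z| + 5` on every input. [folklore] -/
theorem length_searchBody_le (z : List Bool) :
    (searchBody χ p z).length ≤ (sndPow 1 z).length + 0 * ((fstF z).length + 1) + 5 := by
  unfold searchBody
  rw [length_fanoutFn]
  have h1 : ((nextFn ∘ nthF 2) z).length ≤ (nthF 2 z).length + 1 := by
    show (nextFn (nthF 2 z)).length ≤ _
    rw [nextFn_apply]; exact OrbitDecider.Exists.length_next_le _
  have h2 : ((orFn (HashBricks.headBitFn ∘ sndPow 2) (testC χ p)) z).length = 1 :=
    (oneBit_orFn (HashBricks.oneBit_headBitFn.comp _) (oneBit_testC χ p)).length_eq z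
  have h3 : 2 * (nthF 2 z).length ≤ (sndPow 1 z).length := by
    have h := length_fstF_sndF_le (sndPow 1 z)
    have e : nthF 2 z = fstF (sndPow 1 z) := rfl
    rw [e]; omega
  omega

/-- **The model of the search**: `k` rounds from candidate `y` with flag `f` reach candidate
`next^[k] y` with flag `f ∨ ⋁_{j<k} test (next^[j] y)`. [folklore] -/
theorem loopModel_searchBody (r w : List Bool) : ∀ (k : ℕ) (y : List Bool) (f : Bool),
    loopModel (searchBody χ p) (boolPair r w) k (boolPair y [f]) =
      boolPair (next^[k] y) [f || decide (∃ j < k,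
        (χ (boolPair w (next^[j] y))).headD false = true ∧ (next^[j] y).length ≤ p.eval w.length)]
  | 0, y, f => by simp [loopModel]
  | k + 1, y, f => by
    rw [loopModel, searchBody_apply, loopModel_searchBody r w k (next y)]
    simp only [List.headD_cons, Function.iterate_succ_apply]
    congr 2
    rw [Bool.or_assoc]
    congr 1
    rw [Bool.eq_iff_iff]
    simp only [Bool.or_eq_true, Bool.and_eq_true, decide_eq_true_eq]
    constructor
    · rintro (⟨h1, h2⟩ | ⟨j, hj, h1, h2⟩)
      · exact ⟨0, by omega, by simpa using h1, by simpa using h2⟩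
      · exact ⟨j + 1, by omega, by simpa [Function.iterate_succ_apply] using h1,
          by simpa [Function.iterate_succ_apply] using h2⟩
    · rintro ⟨j, hj, h1, h2⟩
      rcases j with _ | j
      · exact Or.inl ⟨by simpa using h1, by simpa using h2⟩
      · exact Or.inr ⟨j, by omega, by simpa [Function.iterate_succ_apply] using h1,
          by simpa [Function.iterate_succ_apply] using h2⟩

/-- **The search brick**: on `⟨r, w⟩`, run the loop with the countdown `1^{p|w|+1}` (the numeral of
`2^{p|w|+1} - 1` candidates) clocked by the whole record, and read the flag.
[cite: AroraBarakCC2009, Claim 2.4 (exhaustive search over all certificates)] -/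
def searchFn : List Bool → List Bool :=
  sndPow 2 ∘ (fun z => (loopStep (searchBody χ p))^[(X : Polynomial ℕ).eval (fstF z).length] z) ∘
    fanoutFn id (fanoutFn (Plumb.polyFn (p + 1) ∘ sndF) (fun _ => boolPair [] [false]))

/-- `searchFn ∈ FP` for `χ ∈ FP`. [cite: AroraBarakCC2009, §1.3 (bounded loops)] -/
theorem searchFn_mem_FP (hχ : χ ∈ FP) : searchFn χ p ∈ FP :=
  comp_mem_FP (sndPow_mem_FP 2) (comp_mem_FP
    (loopFn_mem_FP (searchBody_mem_FP χ p hχ) (c := 5) (fun z => by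
      have := length_searchBody_le χ p z; nlinarith [Nat.zero_le (fstF z).length]) X)
    (fanoutFn_mem_FP OracleCompose.id_mem_FP
      (fanoutFn_mem_FP (comp_mem_FP (Plumb.polyFn_mem_FP _) sndF_mem_FP) (const_mem_FP _))))

open Classical in
/-- **Correctness of the search**: if the record `⟨r, w⟩` is long enough to clock
`2^{p|w|+1} - 1` rounds, the flag is `[∃ y, |y| ≤ p |w| ∧ χ ⟨w, y⟩ starts with 1]`.
[cite: AroraBarakCC2009, Claim 2.4] -/
theorem searchFn_apply {r w : List Bool}
    (hlen : 2 ^ (p.eval w.length + 1) - 1 ≤ (boolPair r w).length) :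
    searchFn χ p (boolPair r w) =
      [decide (∃ y : List Bool, y.length ≤ p.eval w.length ∧ (χ (boolPair w y)).headD false = true)] := by
  have hcnt : Plumb.polyFn (p + 1) w = encodeNat (2 ^ (p.eval w.length + 1) - 1) := by
    rw [Plumb.polyFn_apply, CoinEnum.encodeNat_two_pow_sub_one]; simp
  simp only [searchFn, Function.comp_apply, fanoutFn_apply, id, sndF_boolPair, hcnt, fstF_boolPair,
    eval_X]
  rw [iterate_loopStep _ _ _ _ _ hlen, loopModel_searchBody]
  have key : (∃ j < 2 ^ (p.eval w.length + 1) - 1,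
      (χ (boolPair w (next^[j] []))).headD false = true ∧ (next^[j] []).length ≤ p.eval w.length) ↔
      ∃ y : List Bool, y.length ≤ p.eval w.length ∧ (χ (boolPair w y)).headD false = true := by
    constructor
    · rintro ⟨j, -, h1, h2⟩
      exact ⟨_, h2, h1⟩
    · rintro ⟨y, hy, h1⟩
      obtain ⟨j, hj, hjy⟩ := PolyExistsEnum.exists_cand_eq y
      have hjy' : next^[j] [] = y := hjy
      refine ⟨j, ?_, by rw [hjy']; exact h1, by rw [hjy']; exact hy⟩
      have hmono : 2 ^ y.length ≤ 2 ^ p.eval w.length := Nat.pow_le_pow_right (by omega) hy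
      have h1 : 2 ^ (y.length + 1) = 2 * 2 ^ y.length := by ring
      have h2 : 2 ^ (p.eval w.length + 1) = 2 * 2 ^ p.eval w.length := by ring
      have h3 : 1 ≤ 2 ^ y.length := Nat.one_le_two_pow
      omega
  rw [Bool.decide_congr key]
  simp only [sndPow_succ_boolPair, sndPow_zero_boolPair, Bool.false_or]

end Search

/-! ### Binary powers and comparisons -/

section Arith

/-- **The power loop**: the counted fold of products `acc := acc · ⟦base⟧` over the context
`x' = ⟨r, base⟩` (piece function `sndF ∘ fstF`, clipped to keep the generic growth bound), clocked
by `|x'|`. [cite: AroraBarakCC2009, §1.3 (bounded loops)] -/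
def powLoop : List Bool → List Bool :=
  foldLoop prodFn (clipF 1 (sndF ∘ fstF)) X

/-- `powLoop ∈ FP`. [folklore] -/
theorem powLoop_mem_FP : powLoop ∈ FP :=
  foldLoop_clipF_mem_FP 1 prodFn_mem_FP length_prodFn_le (comp_mem_FP sndF_mem_FP fstF_mem_FP) X

/-- **Binary powers**: `powFn ⟨⟨r, base⟩, bin m⟩ = bin (⟦base⟧ᵐ)` whenever `m ≤ |⟨r, base⟩|`
(`powFn_apply`; the ruler `r` pays for the `m` rounds). [cite: AroraBarakCC2009, §1.3] -/
def powFn : List Bool → List Bool :=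
  sndPow 2 ∘ powLoop ∘ fanoutFn fstF (fanoutFn sndF (fun _ => boolPair (ones 0) (encodeNat 1)))

/-- `powFn ∈ FP`. [folklore] -/
theorem powFn_mem_FP : powFn ∈ FP :=
  comp_mem_FP (sndPow_mem_FP 2) (comp_mem_FP powLoop_mem_FP
    (fanoutFn_mem_FP fstF_mem_FP (fanoutFn_mem_FP sndF_mem_FP (const_mem_FP _))))

/-- **Value of `powFn`.** [folklore] -/
theorem powFn_apply (r base : List Bool) {m : ℕ} (hm : m ≤ (boolPair r base).length) :
    powFn (boolPair (boolPair r base) (encodeNat m)) = encodeNat ((bitsToNat base) ^ m) := by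
  have hm' : m ≤ (X : Polynomial ℕ).eval (boolPair r base).length := by rwa [eval_X]
  simp only [powFn, powLoop, Function.comp_apply, fanoutFn_apply, fstF_boolPair, sndF_boolPair]
  rw [foldLoop_apply _ _ hm' 0 (encodeNat 1), sndPow_succ_boolPair, sndPow_succ_boolPair,
    sndPow_zero_boolPair, foldAcc_clipF (fun j _ _ => by simp; omega), foldAcc_prodFn]
  simp [Finset.prod_const, Finset.card_range]

/-- **The comparison `[⟦a⟧ ≤ ⟦b⟧]`** of two numerals (one-bit). [folklore] -/
def leF : List Bool → List Bool :=
  notFn (ltFn ∘ fanoutFn sndF fstF)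

/-- Value of `leF`. [folklore] -/
@[simp] theorem leF_boolPair (a b : List Bool) : leF (boolPair a b) = [decide (bitsToNat a ≤ bitsToNat b)] := by
  unfold leF
  rw [notFn_apply (b := decide (bitsToNat b < bitsToNat a)) (by simp [Function.comp_apply])]
  by_cases h : bitsToNat a ≤ bitsToNat b
  · simp [h, Nat.not_lt.2 h]
  · simp [h, Nat.lt_of_not_le h]

/-- `leF` is one-bit. [folklore] -/
theorem oneBit_leF : OneBit leF :=
  oneBit_notFn (oneBit_ltFn.comp _)

/-- `leF ∈ FP`. [folklore] -/
theorem leF_mem_FP : leF ∈ FP :=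
  notFn_mem_FP (comp_mem_FP ltFn_mem_FP (fanoutFn_mem_FP sndF_mem_FP fstF_mem_FP))

end Arith

end Ladner

end Literature.Computability.Complexity

end
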